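import Summits.QuantumFields.YangMills.Theorems.UnitScaleTiltProp7CombFlatProjectorTransportT3
import Summits.QuantumFields.YangMills.Theorems.UnitScaleTiltProp7QprimeCombL2Flat
import HarnessLib

/-!
# Route `UnitScaleTilt`, crux K1 «MinimiserStabilityRegPr» (stmt-QuantumFields-19200) — ARCHITECTURE (A′)-comb, THE A6ᶜ CERTIFICATE READ AT THE DISPLAYED SLOT:
# **the flat member of S27ᴸ's N06 row `hN06` ∕ ★p1 g18's coercive socket `hCo` (slots of record `(DeltaEtaSlot, RcombL2, Qkc)`, weight `a₀(c₀∕cB)ℓ³`) MODULO THE ONE OPEN SUB-LEMMA (I3′) «δQ-SLICE»**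
# — px13 g6's ✓`coercive_laplaceAc_one_of_sliceBound_basePt` (at px6's intrinsic `laplaceAc … 1`, projector `Rc 1`) transported by ✓`RcombL2_one_eq_Rc_one`

Cell `ym3-torus` ∕ width seat `ym-ust-19200-w1` (gen 14).  THEOREMS ONLY (0 `def`, 0 `sorry`); `--supports stmt-QuantumFields-19200 --as helper`, count-neutral.
YM₃ on T³ is a ladder rung (R3), not d = 4, not infinite volume, not the Clay problem; nothing here claims the stub, the crux, `hcoS`, COMB-FLAT-COERCIVITY (its (I3′) sub-lemma is the
HYPOTHESIS `hv` below), [B9] Thm 3.11 ∕ N06 at curved backgrounds, or the gap.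

WHY (★p1 g18 05:25:46Z on ✓p699006 `hN06_of_coerciveRow`: «the FLAT MEMBER of `hCo` is [px6∕px13's] theorem by `rw` + `exact` [with ✓`RcombL2_one_eq_Rc_one`]»; ★★OWNER RULINGS g29-№17 (3) A6ᶜ ∕ №18).  The
displayed N06 row of the EX display of record (S27ᴸ, junction E′ ⊂ EX) reads the comb coercive operator at the SLOT OF RECORD `laplaceAK (Δ^η W) (D_W) (RcombL2 W) (D*_W) (Qkc W) (Qkc W)†
(a₀(c₀∕cB)ℓ³)`; the COMB-FLAT lane (px6 g5 ✓p694021∕p695948, px13 g6 ✓`Prop7HilbertTranslation` ∕ ✓`Prop7CombGaugeKernelTranslate` ∕ ✓`Prop7CombFlatProjectorTransport`) certifies the flat member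
at px6's INTRINSIC letters `laplaceAc … 1` (projector `Rc 1`) modulo (I3′) — the `δQ`-slice bound `hv` on the gradient-blind difference `Qkc 1 ∘ τ − Qk 1`.  This file is the two-line
transport to the displayed slot: `laplaceAc … 1 = laplaceAK … (Rc … 1) …` (✓`laplaceAc_eq_laplaceAK`, `rfl`) and `RcombL2 … 1 = Rc … 1` (✓`RcombL2_one_eq_Rc_one`, w1 ✓p698597).

WHAT IS PROVED (ns `…Theorems.Prop7QprimeCombL2`): ★★★`coercive_laplaceAK_RcombL2_one_of_sliceBound` — for `n ≤ K`, weights `c₀ cB > 0`, `a₀ > 0`, `ρ ≥ 0` and px13's (I3′) hypothesis `hv` VERBATIM: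
`(1∕(4·Cst 3 a₀·(2+2ρ)))·‖y‖² ≤ re⟪y, laplaceAK (DeltaEtaSlot F n K c₀ 1) (DL2 … 1) (RcombL2 F n K c₀ 1) (DstarL2 … 1) (Qkc F n K hnK c₀ cB 1) (Qkc …)† ((a₀·(c₀∕cB)·ℓ³ : ℝ) : ℂ) y⟫` for every `y`
— the flat member (`W = 1`, any `e`) of ★p1 g18's `hCo` row with `γ := 1∕(4·Cst 3 a₀·(2+2ρ))` (L-only iff `ρ` is), i.e. A6ᶜ for the displayed comb (COERC) row modulo (I3′).
HONEST SCOPE.  A transport by two landed equations; no estimate of mine; (I3′) «δQ-SLICE» (`hv`, K-uniform `ρ`) is OPEN (★★OWNER №18 (2): named sub-lemma of COMB-FLAT-COERCIVITY); N06 at curved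
backgrounds (`hCo` ∕ `hN06`) is DISPLAYED, XL; nothing of (A′) ∕ E′ ∕ EX ∕ the crux claimed.

References: T. Bałaban, CMP **99** (1985) 389–434 [Balaban1985BackgroundPropagators] (Thm 3.11 p.416, (3.21)–(3.27) pp.394–395); Commun. Math. Phys. **95** (1984) 17–40
[Balaban1984PropagatorsI] (Prop. 1.1 (1.90) p.33); CMP **102** (1985) 277–309 [Balaban1985Variational] ((110)–(111) p.294).
-/

set_option autoImplicit false

noncomputable section

open scoped Matrix.Norms.L2Operator InnerProductSpace BigOperators

namespace Summit.QuantumFields.YangMills.Theorems.Prop7QprimeCombL2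

open Literature.MathematicalPhysics.QuantumFieldTheory.Balaban1983to89
open Literature.MathematicalPhysics.QuantumFieldTheory.Balaban1983to89.T3ContinuumYM3Torus
open B11Eq103H1Complex (BondL2K laplaceAK)
open Summit.QuantumFields.YangMills.Theorems.Prop7SectET3Transport (periodsT3)
open Summit.QuantumFields.YangMills.Theorems.Prop7SectET3HilbertLetters (W₂ toL2 DL2 DstarL2)
open Summit.QuantumFields.YangMills.Theorems.Prop7SectET3WilsonHessian (DeltaEta DeltaEtaSlot)
open Summit.QuantumFields.YangMills.Theorems.Prop7SectET3CurvedPropagators (Qk)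
open Summit.QuantumFields.YangMills.Theorems.Prop7SectET3GaugeProjector (RS)
open Summit.QuantumFields.YangMills.Theorems.Prop7SectET3CombLetters (Qkc laplaceAc laplaceAc_eq_laplaceAK)
open Summit.QuantumFields.YangMills.Theorems.Prop7SPrint (basePt)
open Summit.QuantumFields.YangMills.Theorems.Prop7CombFlatProjectorTransport (coercive_laplaceAc_one_of_sliceBound_basePt)

variable {F : T3Family} {n K : ℕ} (hnK : n ≤ K) {c₀ cB : ℝ} [Fact (0 < c₀)] [Fact (0 < cB)]

/-- ★★★ **A6ᶜ AT THE DISPLAYED SLOT, MODULO (I3′)**: the flat member of the comb (COERC) ∕ N06 row at the slots of record `(DeltaEtaSlot, RcombL2, Qkc)` with print's weight `a₀(c₀∕cB)ℓ³`: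
given px13 g6's (I3′) `δQ`-slice hypothesis `hv` (the gradient-blind difference `Qkc 1 ∘ t_{−x₀} − Qk 1` bounded by `ρ×`(curl form + `R_S`-slice)), for every `y`
`(1∕(4·Cst 3 a₀·(2+2ρ)))·‖y‖² ≤ re⟪y, laplaceAK (Δ^η(1)) (D(1)) (RcombL2 1) (D*(1)) (Qkc 1) (Qkc 1)† (a₀(c₀∕cB)ℓ³) y⟫` — ✓`coercive_laplaceAc_one_of_sliceBound_basePt` ∘ ✓`laplaceAc_eq_laplaceAK` ∘
✓`RcombL2_one_eq_Rc_one`.  [cite: Balaban1985BackgroundPropagators, Thm 3.11 p.416, (3.21) p.394, (3.26) p.395; Balaban1984PropagatorsI, Prop. 1.1 (1.90) p.33] -/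
theorem coercive_laplaceAK_RcombL2_one_of_sliceBound {a₀ : ℝ} (ha₀ : 0 < a₀) {ρ : ℝ} (hρ : 0 ≤ ρ)
    (hv : ∀ X : PBond (F.P K) 0 → Matrix (Fin 2) (Fin 2) ℂ,
      (a₀ * (c₀ / cB) * ((F.L : ℝ) ^ (K - n)) ^ 3)
          * ‖Qkc F n K hnK c₀ cB (1 : GaugeField (F.P K) 0 (Matrix.specialUnitaryGroup (Fin 2) ℂ)) (toL2 F K c₀ (fun b => X (b.translate (-basePt F n K))))
              - Qk F n K hnK c₀ cB (1 : GaugeField (F.P K) 0 (Matrix.specialUnitaryGroup (Fin 2) ℂ)) (toL2 F K c₀ X)‖ ^ 2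
        ≤ ρ * (RCLike.re ⟪toL2 F K c₀ X, DeltaEtaSlot F n K c₀ 1 (toL2 F K c₀ X)⟫_ℂ
              + ‖RS F n K hnK c₀ cB (1 : GaugeField (F.P K) 0 (Matrix.specialUnitaryGroup (Fin 2) ℂ))
                  (DstarL2 F n K c₀ (1 : GaugeField (F.P K) 0 (Matrix.specialUnitaryGroup (Fin 2) ℂ)) (toL2 F K c₀ X))‖ ^ 2))
    (y : BondL2K ℂ 3 (periodsT3 F K) c₀ W₂) :
    (1 / (4 * B5Prop11Plancherel.Cst 3 a₀ * (2 + 2 * ρ))) * ‖y‖ ^ 2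
      ≤ RCLike.re ⟪y, laplaceAK (DeltaEtaSlot F n K c₀ (1 : GaugeField (F.P K) 0 (Matrix.specialUnitaryGroup (Fin 2) ℂ)))
          (DL2 F n K c₀ (1 : GaugeField (F.P K) 0 (Matrix.specialUnitaryGroup (Fin 2) ℂ)))
          (RcombL2 F n K c₀ (1 : GaugeField (F.P K) 0 (Matrix.specialUnitaryGroup (Fin 2) ℂ)))
          (DstarL2 F n K c₀ (1 : GaugeField (F.P K) 0 (Matrix.specialUnitaryGroup (Fin 2) ℂ)))
          (Qkc F n K hnK c₀ cB (1 : GaugeField (F.P K) 0 (Matrix.specialUnitaryGroup (Fin 2) ℂ)))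
          (LinearMap.adjoint (Qkc F n K hnK c₀ cB (1 : GaugeField (F.P K) 0 (Matrix.specialUnitaryGroup (Fin 2) ℂ))))
          (((a₀ * (c₀ / cB) * ((F.L : ℝ) ^ (K - n)) ^ 3 : ℝ) : ℂ)) y⟫_ℂ := by
  have h := coercive_laplaceAc_one_of_sliceBound_basePt (F := F) (n := n) (K := K) (c₀ := c₀) (h := hnK) (cB := cB) ha₀ (DeltaEtaSlot F n K c₀) rfl hρ hv y
  rw [laplaceAc_eq_laplaceAK] at h
  rw [RcombL2_one_eq_Rc_one hnK (cB := cB)]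
  exact h

end Summit.QuantumFields.YangMills.Theorems.Prop7QprimeCombL2

end
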